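import Summits.QuantumFields.YangMills.Theorems.UnitScaleTiltProp7StubEXOfDisplayedRowsW
import Summits.QuantumFields.YangMills.Theorems.UnitScaleTiltProp7ChartPiecesTw
import Summits.QuantumFields.YangMills.Theorems.UnitScaleTiltProp7ChartSigmaT3OfRegPr
import Summits.QuantumFields.YangMills.Theorems.UnitScaleTiltProp7Bound20SymLog
import Summits.QuantumFields.YangMills.Theorems.UnitScaleTiltProp7ChartDatumSplit
import HarnessLib

/-!
# Route `UnitScaleTilt`, crux K1 child «MinimiserStabilityRegPr» (stmt-QuantumFields-19200), skeleton v10, stub `stub_existenceMinimalOrbit` (EX), route (α) — **(CH-KNIT v2.1-tw), FAMILY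
# LEVEL: THE EX KNIT FOR THE TWISTED CHART WITH THE DATUM ROW SPLIT** — the sibling of `Prop7StubEXOfChartPiecesTw.stubEX_of_chartPiecesTw` (v2.0, displayed rows of record per ★★OWNER
# g26 RULING 05:19:07Z) in which the (CH5EL-tw) display is REFINED through the (115)-space dictionary `Prop7ChartDatumSplit`: the chart parameter is PINNED to print's `A′ = A₁ + H₁B`
# ((103), read as a torus field through `ι` in the exponent scale `iη·`, [Balaban1985Variational] (112)), and the datum equation «`Q(U₀)A′ = log(V·Ū₀⁻¹)`» is no longer displayed but DERIVED (`Prop7ChartDatumSplit.datum_of_split`) from the two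
# linear-algebra rows (102)-tw «`Q𝔊 = 0`» and (129)-tw «`QH₁ = id`» (print's normalised `Q(U₀) = η·(QTw U₀ ∘ ι)`, [Balaban1985BackgroundPropagators] (3.14)) about the opaque letters `𝔊(U₀)`, `H₁(U₀)`; the XL content ((112) ∘ Prop. 5 ∘ (123)–(140) ∘ E–L) stays displayed as
# `hXtw′` (∃ X only).  Everything else — `stubEX_of_displayedRows_w` (p606029) at the chart of record, `B := Bsym`, (B20) DISCHARGED (p603003), CHART-112 DISCHARGED through
# `Prop7ChartPiecesTw.hChart_of_piecesTw` ∘ `chartSigmaT3_of_regPr` with (20) a theorem (`fibreClause_of_chart47tw`) — is as in v2.0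

Cell `ym3-torus`, width seat `ym-ust-19200-w2` (gen 3; KNIT RULER per ★★OWNER g26 RULING №1 (4), ACK 4 (a); LOCATE lines 05:14Z ∕ 05:50Z).  THEOREMS ONLY (0 `def`, 0 `sorry`).  CONDITIONAL: the
stub stays OPEN; `--supports stmt-QuantumFields-19200 --as helper`, count-neutral.  YM₃ on T³ is a ladder rung (R3), not the Clay problem; nothing here claims the stub, the crux, d = 4
or the mass gap.

THE KNIT (no new analysis).  Member by member (`i = (F, n, K)`, `B₃* = 3L`, background radius `a = L³·3L·ε₁ ≤ α`): `RegPr a U₀ ⟹ RegPr α U₀` (`regPr_mono`); (46)-tw gives a right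
inverse `H` of `QTw U₀` with `‖H‖ ≤ B_H`; Prop. 3-tw gives `Chart47T3tw … (C₂)_i ε_i U₀ H`; CHART-Σ at `(α, e)` is ★w5 g0's `chartSigmaT3_of_regPr` in its windows; (B20) at the
letter `Bsym` holds by (14) under `L³ε₁ ≤ α∕(3L) ≤ 1∕48` (WS: `2α ≤ ⅛`), so `‖H₁B‖ ≤ 2B₀α` and `M(r + ‖H₁B‖) < e`; `Prop7ChartPiecesTw.hChart_of_piecesTw` assembles CHART-112 with
(20) a THEOREM (★w5-20520 g3's `fibreClause_of_chart47tw`), its `hXtw` input being `Prop7ChartDatumSplit.hXtw_of_split_eta` of {`h102`, `h129`, `hrε`, `hXtw′`} (‖iη·(ι A₁ + ι(H₁B))‖ ≤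
η(‖A₁‖₍₁₁₅₎ + ‖H₁B‖₍₁₁₅₎) < η(r + 2B₀α) ≤ ε₃); then `stubEX_of_displayedRows_w`.

DISPLAYED ROWS of ★★★ **`stubEX_of_chartPiecesTwSplit`** (chart-side letters all RESTRICTED ∕ TWISTED — interface principle (7)): (N06) `norm_G`, `norm_H₁`; (P4) `prop4`; (46)-tw
`h46tw` (∃ right inverse `H` of `Q(U₀) = QTw U₀` with its bound); (CH47-tw) `h47tw` (Prop. 3 for the twisted chart from (45)–(46)); **(102)-tw `h102`** — «`Q𝔊 = 0`»: the range of
`𝔊(U₀)` averages to zero under `QTw U₀` ([Balaban1985Variational] (102), p.294 «satisfying the equalities Q𝔊 = 0»; supplier: `B11Eq111FrakG.apply_Q_frakGLin` once the (115)-space `Q`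
is identified with `QTw U₀`); **(129)-tw `h129`** — «`QH₁B = B`», i.e. `QTw U₀ (ι(H₁B)) = η⁻¹B` ([Balaban1985Variational] (129) `H₁ = G₁Q*(QG₁Q*)⁻¹`; same dictionary item); **(Wr)** `hrε` —
`η(r + 2B₀α) ≤ ε₃` (print's `A′` lies in the ball of Prop. 3, exponent scale); (WIN-tw) `hwinTw`; **(CH5EL-tw)′ `hXtw′`** — (112) ∘ Prop. 5 ∘ (123)–(140) ∘ E–L at `A′ := iη·(ι A₁ + ι(H₁ Bsym))` (XL; ∃ X
only); (WΣ) `hwS`; (WMe); (W137); (GR) `hGrowth`; (T2) `hThm2`.  Relative to v2.0: the row `hXtw` is replaced by {`hXtw′`, `h102`, `h129`, `hrε`} — (102)∕(103)∕PIN-B leave the XL display.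

References: T. Bałaban, CMP 102 (1985) 277–309 [Balaban1985Variational] (Prop. 3 p.289, (44)–(49) p.285, Prop. 5 p.294, (102)–(103) p.293, (111)–(112) p.294, (123)–(142)
pp.296–299, Prop. 7 p.299, (20) p.281); CMP 99 (1985) 75–102 [Balaban1985RegularSpaces] ((1.29)–(1.31) pp.81–82, (1.37) p.82, Thm 2 p.83, Prop. 7 p.98); CMP 99 (1985) 389–434
[Balaban1985BackgroundPropagators] (p.392, Thms 3.12–3.13); CMP 98 (1985) 17–51 [Balaban1985Averaging] ((89)–(92) p.31, Props 4–5 pp.38–42).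
-/

set_option autoImplicit false

noncomputable section

open scoped BigOperators Matrix.Norms.L2Operator Matrix

namespace Summit.QuantumFields.YangMills.Theorems.Prop7StubEXOfChartPiecesTwSplit

open NormedSpace
open Literature.MathematicalPhysics.QuantumFieldTheory.Balaban1983to89
open Literature.MathematicalPhysics.QuantumFieldTheory.Balaban1983to89.T3ContinuumYM3Torus
open Literature.MathematicalPhysics.QuantumFieldTheory.Balaban1983to89.T3UnitLawDensityEML (ℰp)
open Literature.MathematicalPhysics.QuantumFieldTheory.Balaban1983to89.T3TiltDescent (descendTo)
open Literature.MathematicalPhysics.QuantumFieldTheory.Balaban1983to89.T3ConstrainedMinimiser (fibre)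
open Literature.MathematicalPhysics.QuantumFieldTheory.Balaban1983to89.T3PrintedRegularMinimiser (RegPr regFibrePr)
open Literature.MathematicalPhysics.QuantumFieldTheory.Balaban1983to89.T3PrintedRegularOrbits (descTransf)
open Literature.MathematicalPhysics.QuantumFieldTheory.Balaban1983to89.T3PrintedMinimiserExistence (regPr_mono)
open Literature.MathematicalPhysics.QuantumFieldTheory.Balaban1983to89.T3Thm1Carrier
open Literature.MathematicalPhysics.QuantumFieldTheory.Balaban1983to89.T3SectALandauChart (In19 emb15 CloseAvg eta)
open BlockAveragingEMLLinearisedBackground (pertVar)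
open B9SectCLatticeCarrier (Bond)
open B10Eq27TorusAxialLog (unitsField toUField)
open B11Eq115Space (NegSize Space115 JetSup)
open B11Eq111FrakG (nabla115)
open B11Eq98CurrentSlot (Jcur)
open B11Prop3Model (Dfix)
open B13Contraction113 (QuadAnalytic)
open B8Thm2TorusAt (Thm2TorusAt)
open B7Prop2SpecialUnitary (specialUnitaryUnits)
open B7Prop2Explicit (C0 c2')
open B7Prop3Flat (c3)
open MatrixLog (mlog)
open Summit.QuantumFields.YangMills.Theorems.Prop7TPrint (nMax19 expHermField)
open Summit.QuantumFields.YangMills.Theorems.Prop7SPrint (AvgCondPrint IsLandauPrint RestrictedPrint IsAxialPrint)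
open Summit.QuantumFields.YangMills.Theorems.Prop7SectET3Transport (periodsT3 siteEquiv siteEquiv_shiftEquiv bgOfCfg bondEquiv)
open Summit.QuantumFields.YangMills.Theorems.Prop7ChartT3 (ChartSigmaT3)
open Summit.QuantumFields.YangMills.Theorems.Prop7ChartSigmaT3OfRegPr (chartSigmaT3_of_regPr)
open Summit.QuantumFields.YangMills.Theorems.Prop7SymAvgTw (dbarTw QTw CmapTw Chart47T3tw)
open Summit.QuantumFields.YangMills.Theorems.Prop7Bound20SymLog (bound20_symLog_of_closeAvg)
open Summit.QuantumFields.YangMills.Theorems.Prop7ChartPiecesTw (hChart_of_piecesTw)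
open Summit.QuantumFields.YangMills.Theorems.Prop7StubEXOfDisplayedRowsW (stubEX_of_displayedRows_w)
open Summit.QuantumFields.YangMills.Theorems.Prop7ChartDatumSplit (hXtw_of_split_eta)

/-- ★★★ **`stub_existenceMinimalOrbit`'s REGISTERED TEXT FROM THE TWISTED CHART PIECES, DATUM ROW SPLIT** — as `Prop7StubEXOfChartPiecesTw.stubEX_of_chartPiecesTw` (v2.0:
`stubEX_of_displayedRows_w` at the chart of record, `B := Bsym`, (B20) and CHART-112 DISCHARGED, (20) a theorem inside), with the (CH5EL-tw) display refined through
`Prop7ChartDatumSplit.hXtw_of_split_eta`: displayed are (102)-tw `h102` («Q𝔊 = 0»), (129)-tw `h129` («QH₁ = id»), the radius window `hrε`, and `hXtw′` ((112) ∘ Prop. 5 ∘ (123)–(140) ∘ E–L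
at print's `A′ = A₁ + H₁B`, ∃ X only); the datum equation `Q(U₀)A′ = log(V·Ū₀⁻¹)` is DERIVED.  Other rows as v2.0: N06 ×2, Prop. 4, `h46tw`, `h47tw`, `hwinTw`, (WΣ)∕(WMe)∕(W137),
(γ)-growth, Thm 2 sockets.  CONDITIONAL — the stub is not closed. [cite: Balaban1985Variational, Prop. 7 p.299, Prop. 3 p.289, (45)-(49) p.285, (102)-(103) p.293, (111)-(112) p.294, Prop. 5 p.294, (129) p.297, (141)-(142) p.299, (20) p.281; Balaban1985RegularSpaces, Thm 2 p.83, (1.29) p.81, (1.37) p.82, Prop. 7 p.98] -/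
theorem stubEX_of_chartPiecesTwSplit
    [hFL : ∀ F : T3Family, Fact (0 < (F.L : ℝ))] [hFη : ∀ (F : T3Family) (k : ℕ), Fact (0 < ((F.L : ℝ)⁻¹) ^ k)]
    -- the constants, member-uniform at each `L` (print: «absolute constants depending on d and L only»)
    (B₀ C₄ a₃ α r M CP θ cS : ℕ → ℝ) (hB₀ : ∀ L, 1 < L → 0 < B₀ L) (hC₄ : ∀ L, 1 < L → 0 < C₄ L) (ha₃ : ∀ L, 1 < L → 0 < a₃ L)
    (hα : ∀ L, 1 < L → 0 < α L) (hr : ∀ L, 1 < L → 0 < r L) (hM : ∀ L, 1 < L → 0 < M L) (hCP : ∀ L, 1 < L → 0 < CP L)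
    (hθ : ∀ L, 1 < L → θ L < 1 / 2) (hcS : ∀ L, 1 < L → 0 ≤ cS L)
    -- the curved letters `𝔊(U₀)`, `(δ/δA′)V`, `H₁(U₀)`, OPAQUE (the datum `B` is FIXED to `Bsym` on `Λ_k = PBond (P n) 0`)
    (𝒢f : ∀ (L : ℕ) (i : Idx L) (U₀ : GaugeField (i.1.1.P i.1.2.2) 0 (Matrix.specialUnitaryGroup (Fin 2) ℂ)),
      NegSize (i.1.1.L : ℝ) (((i.1.1.L : ℝ)⁻¹) ^ (i.1.2.2 - i.1.2.1)) (fun _ : Bond 3 (periodsT3 i.1.1 i.1.2.2) => i.1.2.2 - i.1.2.1) 3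
          (Matrix (Fin 2) (Fin 2) ℂ) →L[ℂ]
        Space115 (i.1.1.L : ℝ) (((i.1.1.L : ℝ)⁻¹) ^ (i.1.2.2 - i.1.2.1)) (fun _ : Bond 3 (periodsT3 i.1.1 i.1.2.2) => i.1.2.2 - i.1.2.1)
          (fun _ : Bond 3 (periodsT3 i.1.1 i.1.2.2) × Fin 3 => i.1.2.2 - i.1.2.1) (nabla115 (((i.1.1.L : ℝ)⁻¹) ^ (i.1.2.2 - i.1.2.1)) (bgOfCfg i.1.1 i.1.2.2 U₀)))
    (Wf : ∀ (L : ℕ) (i : Idx L) (U₀ : GaugeField (i.1.1.P i.1.2.2) 0 (Matrix.specialUnitaryGroup (Fin 2) ℂ)),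
      Space115 (i.1.1.L : ℝ) (((i.1.1.L : ℝ)⁻¹) ^ (i.1.2.2 - i.1.2.1)) (fun _ : Bond 3 (periodsT3 i.1.1 i.1.2.2) => i.1.2.2 - i.1.2.1)
          (fun _ : Bond 3 (periodsT3 i.1.1 i.1.2.2) × Fin 3 => i.1.2.2 - i.1.2.1) (nabla115 (((i.1.1.L : ℝ)⁻¹) ^ (i.1.2.2 - i.1.2.1)) (bgOfCfg i.1.1 i.1.2.2 U₀)) →
        NegSize (i.1.1.L : ℝ) (((i.1.1.L : ℝ)⁻¹) ^ (i.1.2.2 - i.1.2.1)) (fun _ : Bond 3 (periodsT3 i.1.1 i.1.2.2) => i.1.2.2 - i.1.2.1) 3 (Matrix (Fin 2) (Fin 2) ℂ))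
    (H₁f : ∀ (L : ℕ) (i : Idx L) (U₀ : GaugeField (i.1.1.P i.1.2.2) 0 (Matrix.specialUnitaryGroup (Fin 2) ℂ)),
      (PBond (i.1.1.P i.1.2.1) 0 → Matrix (Fin 2) (Fin 2) ℂ) →L[ℂ]
        Space115 (i.1.1.L : ℝ) (((i.1.1.L : ℝ)⁻¹) ^ (i.1.2.2 - i.1.2.1)) (fun _ : Bond 3 (periodsT3 i.1.1 i.1.2.2) => i.1.2.2 - i.1.2.1)
          (fun _ : Bond 3 (periodsT3 i.1.1 i.1.2.2) × Fin 3 => i.1.2.2 - i.1.2.1) (nabla115 (((i.1.1.L : ℝ)⁻¹) ^ (i.1.2.2 - i.1.2.1)) (bgOfCfg i.1.1 i.1.2.2 U₀)))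
    -- their displayed bounds (the `SectEDatum` fields at admissible backgrounds)
    (norm_G : ∀ (L : ℕ), 1 < L → ∀ (i : Idx L) (ρ : ℝ) (U₀ : GaugeField (i.1.1.P i.1.2.2) 0 (Matrix.specialUnitaryGroup (Fin 2) ℂ)),
      RegPr i.1.1 i.1.2.1 i.1.2.2 ρ U₀ → ρ ≤ α L → ∀ f, ‖𝒢f L i U₀ f‖ ≤ B₀ L * ‖f‖)
    (prop4 : ∀ (L : ℕ), 1 < L → ∀ (i : Idx L) (ρ : ℝ) (U₀ : GaugeField (i.1.1.P i.1.2.2) 0 (Matrix.specialUnitaryGroup (Fin 2) ℂ)),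
      RegPr i.1.1 i.1.2.1 i.1.2.2 ρ U₀ → ρ ≤ α L → QuadAnalytic (Wf L i U₀) (C₄ L) (a₃ L))
    (norm_H₁ : ∀ (L : ℕ), 1 < L → ∀ (i : Idx L) (ρ : ℝ) (U₀ : GaugeField (i.1.1.P i.1.2.2) 0 (Matrix.specialUnitaryGroup (Fin 2) ℂ)),
      RegPr i.1.1 i.1.2.1 i.1.2.2 ρ U₀ → ρ ≤ α L → ∀ b, ‖H₁f L i U₀ b‖ ≤ B₀ L * ‖b‖)
    -- (46)-tw: a right inverse `H` of print's averaging operator `Q(U₀) = QTw U₀` with its bound, at every admissible background (DISPLAYED; suppliers (R1) + (3e))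
    (BH : ℕ → ℝ)
    (h46tw : ∀ (L : ℕ), 1 < L → ∀ (i : Idx L) (U₀ : GaugeField (i.1.1.P i.1.2.2) 0 (Matrix.specialUnitaryGroup (Fin 2) ℂ)), RegPr i.1.1 i.1.2.1 i.1.2.2 (α L) U₀ →
      ∃ H : (PBond (i.1.1.P i.1.2.1) 0 → Matrix (Fin 2) (Fin 2) ℂ) →ₗ[ℂ] (PBond (i.1.1.P i.1.2.2) 0 → Matrix (Fin 2) (Fin 2) ℂ),
        (∀ Y, QTw i.1.1 i.1.2.1 i.1.2.2 i.2.2.le U₀ (H Y) = Y) ∧ ∀ Y, ‖H Y‖ ≤ BH L * ‖Y‖)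
    -- (CH47-tw): Prop. 3 for the twisted chart as an implication from (45)–(46), member-wise constants `C₂`, `ε = ε₃` (DISPLAYED; supplier = the (44)-tw input, not built)
    (C2f εf : ∀ (L : ℕ), Idx L → ℝ)
    (h47tw : ∀ (L : ℕ), 1 < L → ∀ (i : Idx L) (U₀ : GaugeField (i.1.1.P i.1.2.2) 0 (Matrix.specialUnitaryGroup (Fin 2) ℂ))
      (H : (PBond (i.1.1.P i.1.2.1) 0 → Matrix (Fin 2) (Fin 2) ℂ) →ₗ[ℂ] (PBond (i.1.1.P i.1.2.2) 0 → Matrix (Fin 2) (Fin 2) ℂ)), RegPr i.1.1 i.1.2.1 i.1.2.2 (α L) U₀ →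
      (∀ Y, QTw i.1.1 i.1.2.1 i.1.2.2 i.2.2.le U₀ (H Y) = Y) → (∀ Y, ‖H Y‖ ≤ BH L * ‖Y‖) → Chart47T3tw i.1.1 i.1.2.1 i.1.2.2 i.2.2.le (C2f L i) (εf L i) U₀ H)
    -- the windows of `Prop7ChartSigmaT3OfRegPr.chartSigmaT3_of_regPr` at `(ε₀, e) := (α L, e L)` (verbatim from the v1 knit)
    (ef : ℕ → ℝ) (hef : ∀ L, 1 < L → 0 < ef L)
    (hwS : ∀ (L : ℕ), 1 < L → ∀ i : Idx L,
      C0 (i.1.1.P i.1.2.2).d * (2 * α L) ≤ 1 / 3 ∧ 4 * (2 * α L) ≤ c2' (i.1.1.P i.1.2.2).d (i.1.1.P i.1.2.2).L ∧ 2 * α L ≤ 1 / 8 ∧ ef L ≤ 1 / 20 ∧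
      Real.exp (4 * (800 * ((((i.1.1.P i.1.2.2).d : ℕ) : ℝ) + 1) ^ 2 * ((((i.1.1.P i.1.2.2).d : ℕ) : ℝ) + 4)) * (2 * α L))
        * (1 + 8 * (131072 * ((((i.1.1.P i.1.2.2).d : ℕ) : ℝ) + 1) ^ 2) * ef L) ≤ 2 ∧
      2 * ef L ≤ c3 (i.1.1.P i.1.2.2).d (i.1.1.P i.1.2.2).L ∧ 2048 * (((i.1.1.P i.1.2.2).d : ℕ) : ℝ) * ef L ≤ 1 ∧
      C0 (i.1.1.P i.1.2.2).d * (2 * α L + 4 * ef L) ≤ 1 / 3 ∧ 2 * (2 * α L + 4 * ef L) ≤ c2' (i.1.1.P i.1.2.2).d (i.1.1.P i.1.2.2).L)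
    -- the size window linking (CH5EL-tw)'s size row to CHART-Σ's radius, and the regularity window of the log-chart bridges
    (hMe : ∀ L, 1 < L → M L * (r L + 2 * B₀ L * α L) < ef L)
    (hw137 : ∀ L : ℕ, 1 < L → 10 ^ 7 * (L : ℝ) ^ 3 * (178 * (α L + ef L)) ≤ 1)
    -- (WIN-tw): the `log` window of the twisted average at chart points of (19)-size `< e` (DISPLAYED; supplier located)
    (hwinTw : ∀ (L : ℕ), 1 < L → ∀ (i : Idx L) (U₀ : GaugeField (i.1.1.P i.1.2.2) 0 (Matrix.specialUnitaryGroup (Fin 2) ℂ)) (X : PBond (i.1.1.P i.1.2.2) 0 → Matrix (Fin 2) (Fin 2) ℂ),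
      RegPr i.1.1 i.1.2.1 i.1.2.2 (α L) U₀ → (∀ b : PBond (i.1.1.P i.1.2.2) 0, (X b).IsHermitian ∧ Matrix.trace (X b) = 0) → nMax19 i.1.1 i.1.2.1 i.1.2.2 U₀ X < ef L →
      ∀ c : PBond (i.1.1.P i.1.2.1) 0, ‖((dbarTw i.1.1 i.1.2.1 i.1.2.2 i.2.2.le U₀ (fun b => Complex.I • X b) c : (Matrix (Fin 2) (Fin 2) ℂ)ˣ) : Matrix (Fin 2) (Fin 2) ℂ) - 1‖ < 1)
    -- (102)-tw «Q𝔊 = 0» and (129)-tw «QH₁ = id» for print's `Q(U₀) = QTw U₀`, read through the (115)-space dictionary `ι` (DISPLAYED, N06-class rows about the opaque letters)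
    (h102 : ∀ (L : ℕ), 1 < L → ∀ (i : Idx L) (U₀ : GaugeField (i.1.1.P i.1.2.2) 0 (Matrix.specialUnitaryGroup (Fin 2) ℂ)), RegPr i.1.1 i.1.2.1 i.1.2.2 (α L) U₀ →
      ∀ f : NegSize (i.1.1.L : ℝ) (((i.1.1.L : ℝ)⁻¹) ^ (i.1.2.2 - i.1.2.1)) (fun _ : Bond 3 (periodsT3 i.1.1 i.1.2.2) => i.1.2.2 - i.1.2.1) 3 (Matrix (Fin 2) (Fin 2) ℂ),
        QTw i.1.1 i.1.2.1 i.1.2.2 i.2.2.le U₀ (fun b : PBond (i.1.1.P i.1.2.2) 0 => JetSup.equiv _ _ _ (𝒢f L i U₀ f) (bondEquiv i.1.1 i.1.2.2 b)) = 0)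
    (h129 : ∀ (L : ℕ), 1 < L → ∀ (i : Idx L) (U₀ : GaugeField (i.1.1.P i.1.2.2) 0 (Matrix.specialUnitaryGroup (Fin 2) ℂ)), RegPr i.1.1 i.1.2.1 i.1.2.2 (α L) U₀ →
      ∀ B : PBond (i.1.1.P i.1.2.1) 0 → Matrix (Fin 2) (Fin 2) ℂ,
        QTw i.1.1 i.1.2.1 i.1.2.2 i.2.2.le U₀ (fun b : PBond (i.1.1.P i.1.2.2) 0 => JetSup.equiv _ _ _ (H₁f L i U₀ B) (bondEquiv i.1.1 i.1.2.2 b)) =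
          fun c => (((eta i.1.1 i.1.2.1 i.1.2.2 : ℝ) : ℂ))⁻¹ • B c)
    -- the chart-radius window (exponent scale): print's `A′ = A₁ + H₁B` of (103) lies in the `ε₃`-ball of Prop. 3-tw, `η(r + 2B₀α) ≤ ε₃`
    (hrε : ∀ (L : ℕ), 1 < L → ∀ i : Idx L, eta i.1.1 i.1.2.1 i.1.2.2 * (r L + 2 * B₀ L * α L) ≤ εf L i)
    -- (CH5EL-tw)′: (112) ∘ Prop. 5 ∘ (123)–(140) ∘ E–L in the twisted letters at print's `A′ = A₁ + H₁B` read in the exponent scale, `iη·(ι A₁ + ι(H₁B))`, for the `H` of (46)-tw (DISPLAYED, XL)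
    (hXtw' : ∀ (L : ℕ), 1 < L → ∀ (i : Idx L) (ε₁ : ℝ) (V : GaugeField (i.1.1.P i.1.2.1) 0 (Matrix.specialUnitaryGroup (Fin 2) ℂ))
      (U₀ : GaugeField (i.1.1.P i.1.2.2) 0 (Matrix.specialUnitaryGroup (Fin 2) ℂ))
      (H : (PBond (i.1.1.P i.1.2.1) 0 → Matrix (Fin 2) (Fin 2) ℂ) →ₗ[ℂ] (PBond (i.1.1.P i.1.2.2) 0 → Matrix (Fin 2) (Fin 2) ℂ)), 0 < ε₁ → PlaqSmall ε₁ V →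
      RegPr i.1.1 i.1.2.1 i.1.2.2 ((L : ℝ) ^ 3 * (3 * (L : ℝ)) * ε₁) U₀ → CloseAvg i.1.1 i.1.2.1 i.1.2.2 i.2.2.le ((L : ℝ) ^ 3 * ε₁) V U₀ → (L : ℝ) ^ 3 * (3 * (L : ℝ)) * ε₁ ≤ α L →
      (∀ Y, QTw i.1.1 i.1.2.1 i.1.2.2 i.2.2.le U₀ (H Y) = Y) → (∀ Y, ‖H Y‖ ≤ BH L * ‖Y‖) → Chart47T3tw i.1.1 i.1.2.1 i.1.2.2 i.2.2.le (C2f L i) (εf L i) U₀ H →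
      ∀ A₁ : Space115 (i.1.1.L : ℝ) (((i.1.1.L : ℝ)⁻¹) ^ (i.1.2.2 - i.1.2.1)) (fun _ : Bond 3 (periodsT3 i.1.1 i.1.2.2) => i.1.2.2 - i.1.2.1)
          (fun _ : Bond 3 (periodsT3 i.1.1 i.1.2.2) × Fin 3 => i.1.2.2 - i.1.2.1) (nabla115 (((i.1.1.L : ℝ)⁻¹) ^ (i.1.2.2 - i.1.2.1)) (bgOfCfg i.1.1 i.1.2.2 U₀)),
        ‖A₁‖ < r L →
        A₁ + 𝒢f L i U₀ (Jcur (bgOfCfg i.1.1 i.1.2.2 U₀)) + 𝒢f L i U₀ (Wf L i U₀ (A₁ + H₁f L i U₀ (fun c : PBond (i.1.1.P i.1.2.1) 0 =>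
          (-Complex.I) • mlog (((V c : Matrix.specialUnitaryGroup (Fin 2) ℂ) : Matrix (Fin 2) (Fin 2) ℂ)
            * star ((descendTo i.1.1 ℰp i.1.2.1 i.1.2.2 i.2.2.le U₀ c : Matrix.specialUnitaryGroup (Fin 2) ℂ) : Matrix (Fin 2) (Fin 2) ℂ))))) = 0 →
        ∃ X : PBond (i.1.1.P i.1.2.2) 0 → Matrix (Fin 2) (Fin 2) ℂ,
          (∀ b : PBond (i.1.1.P i.1.2.2) 0, (X b).IsHermitian ∧ Matrix.trace (X b) = 0) ∧
          (((eta i.1.1 i.1.2.1 i.1.2.2 : ℝ) : ℂ) * Complex.I) • ((fun b : PBond (i.1.1.P i.1.2.2) 0 => JetSup.equiv _ _ _ A₁ (bondEquiv i.1.1 i.1.2.2 b))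
              + (fun b : PBond (i.1.1.P i.1.2.2) 0 => JetSup.equiv _ _ _ (H₁f L i U₀ (fun c : PBond (i.1.1.P i.1.2.1) 0 =>
          (-Complex.I) • mlog (((V c : Matrix.specialUnitaryGroup (Fin 2) ℂ) : Matrix (Fin 2) (Fin 2) ℂ)
            * star ((descendTo i.1.1 ℰp i.1.2.1 i.1.2.2 i.2.2.le U₀ c : Matrix.specialUnitaryGroup (Fin 2) ℂ) : Matrix (Fin 2) (Fin 2) ℂ)))) (bondEquiv i.1.1 i.1.2.2 b)))
            - H (Dfix (CmapTw i.1.1 i.1.2.1 i.1.2.2 i.2.2.le U₀) H (C2f L i)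
              ((((eta i.1.1 i.1.2.1 i.1.2.2 : ℝ) : ℂ) * Complex.I) • ((fun b : PBond (i.1.1.P i.1.2.2) 0 => JetSup.equiv _ _ _ A₁ (bondEquiv i.1.1 i.1.2.2 b))
              + (fun b : PBond (i.1.1.P i.1.2.2) 0 => JetSup.equiv _ _ _ (H₁f L i U₀ (fun c : PBond (i.1.1.P i.1.2.1) 0 =>
          (-Complex.I) • mlog (((V c : Matrix.specialUnitaryGroup (Fin 2) ℂ) : Matrix (Fin 2) (Fin 2) ℂ)
            * star ((descendTo i.1.1 ℰp i.1.2.1 i.1.2.2 i.2.2.le U₀ c : Matrix.specialUnitaryGroup (Fin 2) ℂ) : Matrix (Fin 2) (Fin 2) ℂ)))) (bondEquiv i.1.1 i.1.2.2 b)))))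
            = (fun b => Complex.I • X b) ∧
          nMax19 i.1.1 i.1.2.1 i.1.2.2 U₀ X ≤ M L * (‖A₁‖ + ‖H₁f L i U₀ (fun c : PBond (i.1.1.P i.1.2.1) 0 =>
          (-Complex.I) • mlog (((V c : Matrix.specialUnitaryGroup (Fin 2) ℂ) : Matrix (Fin 2) (Fin 2) ℂ)
            * star ((descendTo i.1.1 ℰp i.1.2.1 i.1.2.2 i.2.2.le U₀ c : Matrix.specialUnitaryGroup (Fin 2) ℂ) : Matrix (Fin 2) (Fin 2) ℂ)))‖) ∧
          IsLandauPrint i.1.1 i.1.2.1 i.1.2.2 U₀ X ∧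
          (∀ u : GaugeTransf (i.1.1.P i.1.2.2) 0 (Matrix.specialUnitaryGroup (Fin 2) ℂ), RestrictedPrint i.1.1 i.1.2.1 i.1.2.2 U₀ u →
            GaugeField.gaugeAct u (emb15 U₀ (expHermField X)) ∈ fibre i.1.1 ℰp i.1.2.1 i.1.2.2 i.2.2.le V →
            ∀ γ : ℝ → GaugeField (i.1.1.P i.1.2.2) 0 (Matrix.specialUnitaryGroup (Fin 2) ℂ), γ 0 = GaugeField.gaugeAct u (emb15 U₀ (expHermField X)) →
              (∀ t, γ t ∈ fibre i.1.1 ℰp i.1.2.1 i.1.2.2 i.2.2.le V) →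
              (∀ b, DifferentiableAt ℝ (fun t => ((γ t b : Matrix.specialUnitaryGroup (Fin 2) ℂ) : Matrix (Fin 2) (Fin 2) ℂ)) 0) →
                deriv (fun t => wilsonAction4 (γ t)) 0 = 0))
    -- (ii) the (γ)-input of ★w4's `growth142_T3`, displayed member-uniformly (verbatim from the v1 knit)
    (hGrowth : ∀ (L : ℕ), 1 < L → ∀ (i : Idx L) (ε₁ ε₄ : ℝ) (V : GaugeField (i.1.1.P i.1.2.1) 0 (Matrix.specialUnitaryGroup (Fin 2) ℂ))
      (U₀ : GaugeField (i.1.1.P i.1.2.2) 0 (Matrix.specialUnitaryGroup (Fin 2) ℂ)) (X : PBond (i.1.1.P i.1.2.2) 0 → Matrix (Fin 2) (Fin 2) ℂ)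
      (u : GaugeTransf (i.1.1.P i.1.2.2) 0 (Matrix.specialUnitaryGroup (Fin 2) ℂ)) (W : GaugeField (i.1.1.P i.1.2.2) 0 (Matrix.specialUnitaryGroup (Fin 2) ℂ)),
      0 < ε₁ → ε₄ ≤ 1 / 4 → (L : ℝ) ^ 3 * (3 * (L : ℝ)) * ε₁ ≤ ε₄ → PlaqSmall ε₁ V → RegPr i.1.1 i.1.2.1 i.1.2.2 ((L : ℝ) ^ 3 * (3 * (L : ℝ)) * ε₁) U₀ →
      CloseAvg i.1.1 i.1.2.1 i.1.2.2 i.2.2.le ((L : ℝ) ^ 3 * ε₁) V U₀ → (∀ b : PBond (i.1.1.P i.1.2.2) 0, (X b).IsHermitian ∧ Matrix.trace (X b) = 0) →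
      nMax19 i.1.1 i.1.2.1 i.1.2.2 U₀ X < ε₄ → AvgCondPrint i.1.1 i.1.2.1 i.1.2.2 i.2.2.le V U₀ X → IsLandauPrint i.1.1 i.1.2.1 i.1.2.2 U₀ X →
      RestrictedPrint i.1.1 i.1.2.1 i.1.2.2 U₀ u → W = GaugeField.gaugeAct u (emb15 U₀ (expHermField X)) → IsAxialPrint i.1.1 i.1.2.1 i.1.2.2 U₀ W →
      W ∈ fibre i.1.1 ℰp i.1.2.1 i.1.2.2 i.2.2.le V →
      (∀ γ : ℝ → GaugeField (i.1.1.P i.1.2.2) 0 (Matrix.specialUnitaryGroup (Fin 2) ℂ), γ 0 = W → (∀ t, γ t ∈ fibre i.1.1 ℰp i.1.2.1 i.1.2.2 i.2.2.le V) →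
        (∀ b, DifferentiableAt ℝ (fun t => ((γ t b : Matrix.specialUnitaryGroup (Fin 2) ℂ) : Matrix (Fin 2) (Fin 2) ℂ)) 0) →
          deriv (fun t => wilsonAction4 (γ t)) 0 = 0) →
      ∀ W' : GaugeField (i.1.1.P i.1.2.2) 0 (Matrix.specialUnitaryGroup (Fin 2) ℂ), W' ∈ regFibrePr i.1.1 i.1.2.1 i.1.2.2 i.2.2.le (178 * ε₄) V →
        ∃ g : GaugeTransf (i.1.1.P i.1.2.2) 0 (Matrix.specialUnitaryGroup (Fin 2) ℂ), descTransf i.1.1 i.1.2.1 i.1.2.2 i.2.2.le g = (fun _ => 1) ∧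
          (∑ b : PBond (i.1.1.P i.1.2.2) 0, ‖pertVar W (GaugeField.gaugeAct g W') b‖ ^ 2 ≤
            CP L * ((i.1.1.L : ℝ) ^ (i.1.2.2 - i.1.2.1)) ^ 2 * ∑ p : Plaq (i.1.1.P i.1.2.2) 0,
              ‖((GaugeField.plaqHol (GaugeField.gaugeAct g W') p : Matrix.specialUnitaryGroup (Fin 2) ℂ) : Matrix (Fin 2) (Fin 2) ℂ)
                  * star ((GaugeField.plaqHol W p : Matrix.specialUnitaryGroup (Fin 2) ℂ) : Matrix (Fin 2) (Fin 2) ℂ) - 1‖ ^ 2) ∧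
          (-(θ L * ∑ p : Plaq (i.1.1.P i.1.2.2) 0,
              ‖((GaugeField.plaqHol (GaugeField.gaugeAct g W') p : Matrix.specialUnitaryGroup (Fin 2) ℂ) : Matrix (Fin 2) (Fin 2) ℂ)
                  * star ((GaugeField.plaqHol W p : Matrix.specialUnitaryGroup (Fin 2) ℂ) : Matrix (Fin 2) (Fin 2) ℂ) - 1‖ ^ 2) -
              (cS L * ε₄ * (((i.1.1.L : ℝ) ^ (i.1.2.2 - i.1.2.1)) ^ 2)⁻¹) * ∑ b : PBond (i.1.1.P i.1.2.2) 0, ‖pertVar W (GaugeField.gaugeAct g W') b‖ ^ 2 ≤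
            ∑ p : Plaq (i.1.1.P i.1.2.2) 0, (1 / 2) * ((((((GaugeField.plaqHol W p : Matrix.specialUnitaryGroup (Fin 2) ℂ) : Matrix (Fin 2) (Fin 2) ℂ)) - 1)ᴴ
              * (((((GaugeField.gaugeAct g W' ⟨p.src, p.μ⟩ : Matrix.specialUnitaryGroup (Fin 2) ℂ) : Matrix (Fin 2) (Fin 2) ℂ) * star (W ⟨p.src, p.μ⟩ : Matrix (Fin 2) (Fin 2) ℂ) - 1)
                  + (W ⟨p.src, p.μ⟩ : Matrix (Fin 2) (Fin 2) ℂ)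
                      * (((GaugeField.gaugeAct g W' ⟨p.src.shift p.μ, p.ν⟩ : Matrix.specialUnitaryGroup (Fin 2) ℂ) : Matrix (Fin 2) (Fin 2) ℂ) *
                          star (W ⟨p.src.shift p.μ, p.ν⟩ : Matrix (Fin 2) (Fin 2) ℂ) - 1)
                      * star (W ⟨p.src, p.μ⟩ : Matrix (Fin 2) (Fin 2) ℂ)
                  - ((W ⟨p.src, p.μ⟩ * W ⟨p.src.shift p.μ, p.ν⟩ * (W ⟨p.src.shift p.ν, p.μ⟩)⁻¹ : Matrix.specialUnitaryGroup (Fin 2) ℂ) :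
                        Matrix (Fin 2) (Fin 2) ℂ)
                      * (((GaugeField.gaugeAct g W' ⟨p.src.shift p.ν, p.μ⟩ : Matrix.specialUnitaryGroup (Fin 2) ℂ) : Matrix (Fin 2) (Fin 2) ℂ) *
                          star (W ⟨p.src.shift p.ν, p.μ⟩ : Matrix (Fin 2) (Fin 2) ℂ) - 1)
                      * star ((W ⟨p.src, p.μ⟩ * W ⟨p.src.shift p.μ, p.ν⟩ * (W ⟨p.src.shift p.ν, p.μ⟩)⁻¹ : Matrix.specialUnitaryGroup (Fin 2) ℂ) :
                        Matrix (Fin 2) (Fin 2) ℂ)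
                  - ((GaugeField.plaqHol W p : Matrix.specialUnitaryGroup (Fin 2) ℂ) : Matrix (Fin 2) (Fin 2) ℂ)
                      * (((GaugeField.gaugeAct g W' ⟨p.src, p.ν⟩ : Matrix.specialUnitaryGroup (Fin 2) ℂ) : Matrix (Fin 2) (Fin 2) ℂ) * star (W ⟨p.src, p.ν⟩ : Matrix (Fin 2) (Fin 2) ℂ) - 1)
                      * star ((GaugeField.plaqHol W p : Matrix.specialUnitaryGroup (Fin 2) ℂ) : Matrix (Fin 2) (Fin 2) ℂ))
                * ((GaugeField.plaqHol W p : Matrix.specialUnitaryGroup (Fin 2) ℂ) : Matrix (Fin 2) (Fin 2) ℂ))).trace).re))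
    -- (T2) the [B8] Thm 2 torus sockets, one `(B₁, c₁)` per `L`
    (hThm2 : ∀ (L : ℕ), 1 < L → ∃ B₁ c₁ : ℝ, 0 < B₁ ∧ 0 < c₁ ∧ ∀ (F : T3Family), F.L = L → ∀ (n K : ℕ), n < K →
      ∃ (β₀ B₂ : ℝ) (len : B7Prop1Explicit.Site (F.P K).d → ℝ),
        Thm2TorusAt (F.P K).L (K - n) ((((F.P K).sitesPerDir 0 : ℕ) : ℤ)) (eta F n K) β₀ B₁ B₂ c₁ len (specialUnitaryUnits (Fin 2)) (fun _ => True)) :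
    ∀ (L : ℕ), 1 < L → ∀ (B₃ : ℝ), 4 < B₃ → ∃ a₁' O₁ : ℝ, 0 < a₁' ∧ 1 ≤ O₁ ∧
    ∀ (F : T3Family), F.L = L → ∀ (n K : ℕ) (hnK : n < K) (ε₁ : ℝ), 0 < ε₁ →
      ∀ V : GaugeField (F.P n) 0 (Matrix.specialUnitaryGroup (Fin 2) ℂ), PlaqSmall ε₁ V →
        ∀ U₀ : GaugeField (F.P K) 0 (Matrix.specialUnitaryGroup (Fin 2) ℂ), RegPr F n K ((L : ℝ) ^ 3 * B₃ * ε₁) U₀ → U₀ ∈ fibre F ℰp n K hnK.le V →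
          ε₁ ≤ a₁' → ∃ U ∈ regFibrePr F n K hnK.le (O₁ * (L : ℝ) ^ 3 * B₃ * ε₁) V,
            IsMinOn (fun W : GaugeField (F.P K) 0 (Matrix.specialUnitaryGroup (Fin 2) ℂ) => wilsonAction4 W)
              (regFibrePr F n K hnK.le (O₁ * (L : ℝ) ^ 3 * B₃ * ε₁) V) U := by
  -- `stubEX_of_displayedRows_w` at the chart of record, `β := Λ_k`, `B := Bsym`; two rows to discharge: (B20) and CHART-112
  refine stubEX_of_displayedRows_w (fun L i => periodsT3 i.1.1 i.1.2.2) (fun L i => siteEquiv i.1.1 i.1.2.2) (fun L i x μ => siteEquiv_shiftEquiv i.1.1 i.1.2.2 x μ)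
    B₀ C₄ a₃ α r M CP θ cS hB₀ hC₄ ha₃ hα hr hM hCP hθ hcS 𝒢f Wf (fun L i => PBond (i.1.1.P i.1.2.1) 0) H₁f
    (fun L i V U₀ => fun c : PBond (i.1.1.P i.1.2.1) 0 =>
      (-Complex.I) • mlog (((V c : Matrix.specialUnitaryGroup (Fin 2) ℂ) : Matrix (Fin 2) (Fin 2) ℂ)
        * star ((descendTo i.1.1 ℰp i.1.2.1 i.1.2.2 i.2.2.le U₀ c : Matrix.specialUnitaryGroup (Fin 2) ℂ) : Matrix (Fin 2) (Fin 2) ℂ)))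
    norm_G prop4 norm_H₁ ?_ ?_ hGrowth hThm2
  · -- (B20) DISCHARGED at the letter `Bsym` (★w4-19200 g2), window `L³ε₁ ≤ α∕(3L) ≤ 1∕48` from WS `2α ≤ ⅛`
    intro L hL i ε₁ V U₀ hε₁ _hV _hreg hclose hαe
    have hFL' : (i.1.1.L : ℝ) = (L : ℝ) := by exact_mod_cast i.2.1
    have hL1 : (1 : ℝ) ≤ (L : ℝ) := by exact_mod_cast hL.le
    obtain ⟨-, -, s3, -⟩ := hwS L hL i
    have hwin : (i.1.1.L : ℝ) ^ 3 * ε₁ ≤ 1 / 2 := by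
      rw [hFL']
      have h3 : (L : ℝ) ^ 3 * ε₁ ≤ (L : ℝ) ^ 3 * (3 * (L : ℝ)) * ε₁ := by
        have h0 : 0 ≤ (L : ℝ) ^ 3 * ε₁ := by positivity
        nlinarith
      linarith
    have hclose' : CloseAvg i.1.1 i.1.2.1 i.1.2.2 i.2.2.le ((i.1.1.L : ℝ) ^ 3 * ε₁) V U₀ := by rw [hFL']; exact hclose
    have hB := bound20_symLog_of_closeAvg i.1.1 i.2.2.le hε₁ hwin V U₀ hclose'
    have hrad : (i.1.1.L : ℝ) ^ 3 * ε₁ = (L : ℝ) ^ 3 * ε₁ := by rw [hFL']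
    rw [hrad] at hB
    exact hB
  · -- CHART-112 DISCHARGED: (46)-tw ∃H, Prop. 3-tw, CHART-Σ (PROVED), the member-level knit `hChart_of_piecesTw`
    intro L hL i ε₁ V U₀ hε₁ hV hreg hclose hαe A₁ hA₁ hsol
    have hFL' : (i.1.1.L : ℝ) = (L : ℝ) := by exact_mod_cast i.2.1
    have hL0 : (0 : ℝ) < (L : ℝ) := by exact_mod_cast (show 0 < L by omega)
    have hL1 : (1 : ℝ) ≤ (L : ℝ) := by exact_mod_cast hL.le
    obtain ⟨s1, s2, s3, s4, s5, s6, s7, s8, s9⟩ := hwS L hL i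
    -- the background at the window radius `α L`
    have hregα : RegPr i.1.1 i.1.2.1 i.1.2.2 (α L) U₀ := regPr_mono i.1.1 hαe hreg
    -- (46)-tw and Prop. 3-tw at this background
    obtain ⟨H, hQH, hHB⟩ := h46tw L hL i U₀ hregα
    have h47 := h47tw L hL i U₀ H hregα hQH hHB
    -- CHART-Σ (PROVED)
    have hSig : ChartSigmaT3 i.1.1 i.1.2.1 i.1.2.2 (ef L) U₀ :=
      chartSigmaT3_of_regPr i.1.1 (hα L hL) (hef L hL) s1 s2 s3 s4 s5 s6 s7 s8 s9 U₀ hregα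
    -- ‖H₁B‖ ≤ 2B₀α from `norm_H₁` ∘ (B20) and `L³·3L·ε₁ ≤ α`
    have hwin : (i.1.1.L : ℝ) ^ 3 * ε₁ ≤ 1 / 2 := by
      rw [hFL']
      have h3 : (L : ℝ) ^ 3 * ε₁ ≤ (L : ℝ) ^ 3 * (3 * (L : ℝ)) * ε₁ := by
        have h0 : 0 ≤ (L : ℝ) ^ 3 * ε₁ := by positivity
        nlinarith
      linarith
    have hclose' : CloseAvg i.1.1 i.1.2.1 i.1.2.2 i.2.2.le ((i.1.1.L : ℝ) ^ 3 * ε₁) V U₀ := by rw [hFL']; exact hclose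
    have hB := bound20_symLog_of_closeAvg i.1.1 i.2.2.le hε₁ hwin V U₀ hclose'
    have hH₁B : ‖H₁f L i U₀ (fun c : PBond (i.1.1.P i.1.2.1) 0 =>
        (-Complex.I) • mlog (((V c : Matrix.specialUnitaryGroup (Fin 2) ℂ) : Matrix (Fin 2) (Fin 2) ℂ)
          * star ((descendTo i.1.1 ℰp i.1.2.1 i.1.2.2 i.2.2.le U₀ c : Matrix.specialUnitaryGroup (Fin 2) ℂ) : Matrix (Fin 2) (Fin 2) ℂ)))‖ ≤ 2 * B₀ L * α L := by
      have h0 := norm_H₁ L hL i _ U₀ hreg hαe (fun c : PBond (i.1.1.P i.1.2.1) 0 =>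
        (-Complex.I) • mlog (((V c : Matrix.specialUnitaryGroup (Fin 2) ℂ) : Matrix (Fin 2) (Fin 2) ℂ)
          * star ((descendTo i.1.1 ℰp i.1.2.1 i.1.2.2 i.2.2.le U₀ c : Matrix.specialUnitaryGroup (Fin 2) ℂ) : Matrix (Fin 2) (Fin 2) ℂ)))
      have hB' : ‖(fun c : PBond (i.1.1.P i.1.2.1) 0 =>
          (-Complex.I) • mlog (((V c : Matrix.specialUnitaryGroup (Fin 2) ℂ) : Matrix (Fin 2) (Fin 2) ℂ)
            * star ((descendTo i.1.1 ℰp i.1.2.1 i.1.2.2 i.2.2.le U₀ c : Matrix.specialUnitaryGroup (Fin 2) ℂ) : Matrix (Fin 2) (Fin 2) ℂ)))‖ ≤ 2 * α L := by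
        have h3 : 2 * ((3 : ℝ) * i.1.1.L) * ((i.1.1.L : ℝ) ^ 3 * ε₁) = 2 * ((L : ℝ) ^ 3 * (3 * (L : ℝ)) * ε₁) := by rw [hFL']; ring
        rw [h3] at hB
        linarith
      calc _ ≤ B₀ L * _ := h0
        _ ≤ B₀ L * (2 * α L) := mul_le_mul_of_nonneg_left hB' (hB₀ L hL).le
        _ = 2 * B₀ L * α L := by ring
    have hMe' : M L * (r L + ‖H₁f L i U₀ (fun c : PBond (i.1.1.P i.1.2.1) 0 =>
        (-Complex.I) • mlog (((V c : Matrix.specialUnitaryGroup (Fin 2) ℂ) : Matrix (Fin 2) (Fin 2) ℂ)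
          * star ((descendTo i.1.1 ℰp i.1.2.1 i.1.2.2 i.2.2.le U₀ c : Matrix.specialUnitaryGroup (Fin 2) ℂ) : Matrix (Fin 2) (Fin 2) ℂ)))‖) < ef L := by
      have : M L * (r L + ‖H₁f L i U₀ (fun c : PBond (i.1.1.P i.1.2.1) 0 =>
        (-Complex.I) • mlog (((V c : Matrix.specialUnitaryGroup (Fin 2) ℂ) : Matrix (Fin 2) (Fin 2) ℂ)
          * star ((descendTo i.1.1 ℰp i.1.2.1 i.1.2.2 i.2.2.le U₀ c : Matrix.specialUnitaryGroup (Fin 2) ℂ) : Matrix (Fin 2) (Fin 2) ℂ)))‖) ≤ M L * (r L + 2 * B₀ L * α L) :=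
        mul_le_mul_of_nonneg_left (by linarith) (hM L hL).le
      exact lt_of_le_of_lt this (hMe L hL)
    -- the numeric windows of the member-level knit
    have hα16 : α L ≤ 1 / 16 := by linarith
    have hb1 : (L : ℝ) ^ 3 * ε₁ ≤ 1 := by
      have h3 : (L : ℝ) ^ 3 * ε₁ ≤ (L : ℝ) ^ 3 * (3 * (L : ℝ)) * ε₁ := by
        have h0 : 0 ≤ (L : ℝ) ^ 3 * ε₁ := by positivity
        nlinarith
      linarith
    have hw137' : 10 ^ 7 * (i.1.1.L : ℝ) ^ 3 * (178 * (α L + ef L)) ≤ 1 := by rw [hFL']; exact hw137 L hL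
    exact hChart_of_piecesTw i.1.1 i.2.2.le (hα L hL) hα16 (hef L hL) s4 hb1 hw137' hregα hclose h47 hQH hSig (hwinTw L hL i U₀ · hregα)
      (hXtw_of_split_eta i.1.1 i.2.2.le (h102 L hL i U₀ hregα) (h129 L hL i U₀ hregα) hH₁B (hrε L hL i)
        (hXtw' L hL i ε₁ V U₀ H hε₁ hV hreg hclose hαe hQH hHB h47)) (hM L hL).le hMe' A₁ hA₁ hsol

end Summit.QuantumFields.YangMills.Theorems.Prop7StubEXOfChartPiecesTwSplit

end
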